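import Summits.Ventures.PercRepro.SixThreeShares

/-!
# PercRepro — the `(7,3)` cell, (R6) part (a): the triple-witness line-fibre bound (night-3, gen 4)

For a plane `G`, `B ⊆ G` of rank `3` with `b = |B|`, and a `3`-set `X` off `G`, the witness `S = B ∪ X` has
`S ∩ G = B`, so `D(S) = 6^{b−3} + Σ_{P ≠ G} f(P, S)`.  The planes `P ≠ G` of `M|S`:
* `P ∩ B` of rank `2`: `P ∩ B = L ∩ B` for a line `L` of `M|B` (`k = |L ∩ B|` points) and `P = cl(L ∪ {w})` for every
  `w ∈ P ∩ X`; the planes through `L` partition `X` into classes, a class of size `m` has trace `k + m` and weight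
  `6^{k+m−3}`: a line contributes `≤ 36 · 6^{k−2}` (one class of size `3`), `≤ 7 · 6^{k−2}` when `ρ(B ∪ X) ≥ 5`
  (no class of size `3`) and `≤ 3 · 6^{k−2}` when `ρ(B ∪ X) = 6` (no class of size `2`) — `triple_fibre_le`;
* `P ∩ B = ∅`: `P = cl(X)`, weight `1`, at most one plane;
* `P ∩ B = {a}`: either the one plane `cl({a} ∪ X)` (trace `4`, weight `6`) or up to three planes `cl({a, w, w′})`
  (weight `1` each): `≤ 6` per point, and `≤ 3` when `ρ(B ∪ X) = 6` — `point_fibre_le` (part B).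
Hence (`SevenThreeTripleWitnessB.lean`: `D_triple_le`, `D_triple_le_rank_five`, `D_triple_le_generic`)
`D(B ∪ X) ≤ 6^{b−3} + 36Λ + 6b + 1`, `≤ 6^{b−3} + 7Λ + 6b + 1` (`ρ(B ∪ X) ≥ 5`), `≤ 6^{b−3} + 3Λ + 3b + 1`
(`ρ(B ∪ X) = 6`): mine-2 §26.1's denominators of `w₃⁼`, `w₃⁻`, `w₃`.  Imports `SixThreeShares` (p2).  Axioms: standard.
-/

namespace PercRepro

namespace SevenThree

open Finset ThmH SixThree

variable {α : Type*} [DecidableEq α] {M : Matroid α} [M.Finite]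

omit [M.Finite] in
/-- `(B ∪ X) ∩ G = B` when `B ⊆ G` and `X` is disjoint from `G`. -/
theorem union_inter_eq_of_disjoint {G B X : Finset α} (hB : B ⊆ G) (hXG : Disjoint X G) :
    (B ∪ X) ∩ G = B := by
  ext y
  simp only [Finset.mem_inter, Finset.mem_union]
  constructor
  · rintro ⟨hy | hy, hyG⟩
    · exact hy
    · exact absurd hyG (Finset.disjoint_left.1 hXG hy)
  · intro hy
    exact ⟨Or.inl hy, hB hy⟩

omit [M.Finite] in
/-- The trace of `B ∪ X` on `P` is `(P ∩ B) ∪ (P ∩ X)`. -/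
theorem trace_union_eq (P B X : Finset α) : (B ∪ X) ∩ P = (P ∩ B) ∪ (P ∩ X) := by
  ext y
  simp only [Finset.mem_inter, Finset.mem_union]
  tauto

omit [M.Finite] in
/-- `|(B ∪ X) ∩ P| ≤ |P ∩ B| + |P ∩ X|`. -/
theorem trace_union_card_le (P B X : Finset α) : ((B ∪ X) ∩ P).card ≤ (P ∩ B).card + (P ∩ X).card := by
  rw [trace_union_eq]
  exact Finset.card_union_le _ _

/-- A plane `P ≠ G` with a rank-`3` trace on `B ∪ X` (`B ⊆ G`) meets `X`. -/
theorem triple_meets {G P B X : Finset α} (hG : G ∈ planes M) (hP : P ∈ planes M) (hne : P ≠ G)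
    (hB : B ⊆ G) (hr3 : M.eRk (((B ∪ X) ∩ P : Finset α) : Set α) = 3) : (P ∩ X).Nonempty := by
  by_contra h
  rw [Finset.not_nonempty_iff_eq_empty] at h
  have heq : (B ∪ X) ∩ P = P ∩ B := by
    rw [trace_union_eq, h, Finset.union_empty]
  have hle2 := eRk_inter_le_two hG hP hne hB
  rw [heq] at hr3
  rw [hr3] at hle2
  exact absurd hle2 (by decide)

omit [DecidableEq α] [M.Finite] in
/-- `ρ(X) ≤ |X|`. -/
theorem eRk_le_card (X : Finset α) : M.eRk (X : Set α) ≤ (X.card : ℕ∞) := by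
  have h := M.eRk_le_encard (X : Set α)
  rwa [Set.encard_coe_eq_coe_finsetCard] at h

/-- **The class-size count.**  For weights `m i ≥ 1` with `Σ m i ≤ 3` (the sizes of the classes of a partition of a
`3`-set), `Σ 6^{m i − 1} ≤ 36`; `≤ 7` when every `m i ≤ 2`; `≤ 3` when every `m i ≤ 1`. -/
theorem sum_six_pow_classes_le {ι : Type*} [DecidableEq ι] (F : Finset ι) (m : ι → ℕ)
    (h1 : ∀ i ∈ F, 1 ≤ m i) (h3 : ∑ i ∈ F, m i ≤ 3) :
    ∑ i ∈ F, (6 : ℚ) ^ (m i - 1) ≤ 36 ∧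
    ((∀ i ∈ F, m i ≤ 2) → ∑ i ∈ F, (6 : ℚ) ^ (m i - 1) ≤ 7) ∧
    ((∀ i ∈ F, m i ≤ 1) → ∑ i ∈ F, (6 : ℚ) ^ (m i - 1) ≤ 3) := by
  by_cases hbig : ∃ i₀ ∈ F, 2 ≤ m i₀
  · obtain ⟨i₀, hi₀, hm₀⟩ := hbig
    have hsplit := Finset.add_sum_erase F (fun i => (6 : ℚ) ^ (m i - 1)) hi₀
    have hsplitm := Finset.add_sum_erase F m hi₀
    -- every other class has size exactly `1`
    have hrest : ∀ i ∈ F.erase i₀, m i = 1 := by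
      intro i hi
      have hi' : i ∈ F := Finset.mem_of_mem_erase hi
      have hle : m i ≤ ∑ j ∈ F.erase i₀, m j := Finset.single_le_sum (fun j _ => Nat.zero_le _) hi
      have := h1 i hi'
      omega
    have hrestsum : ∑ i ∈ F.erase i₀, (6 : ℚ) ^ (m i - 1) = ((F.erase i₀).card : ℚ) := by
      rw [Finset.sum_congr rfl (fun i hi => by rw [hrest i hi, Nat.sub_self, pow_zero])]
      rw [Finset.sum_const, nsmul_eq_mul, mul_one]
    have hcardrest : (F.erase i₀).card ≤ 3 - m i₀ := by
      have : ∑ i ∈ F.erase i₀, m i = (F.erase i₀).card := by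
        rw [Finset.sum_congr rfl (fun i hi => hrest i hi), Finset.sum_const, smul_eq_mul, mul_one]
      omega
    have hm₀3 : m i₀ ≤ 3 := by
      have hle : m i₀ ≤ ∑ j ∈ F, m j := Finset.single_le_sum (fun j _ => Nat.zero_le _) hi₀
      omega
    have hsum : ∑ i ∈ F, (6 : ℚ) ^ (m i - 1) = (6 : ℚ) ^ (m i₀ - 1) + ((F.erase i₀).card : ℚ) := by
      rw [← hsplit, hrestsum]
    refine ⟨?_, ?_, ?_⟩
    · rw [hsum]
      rcases (show m i₀ = 2 ∨ m i₀ = 3 by omega) with h | h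
      · rcases (show (F.erase i₀).card = 0 ∨ (F.erase i₀).card = 1 by omega) with hc | hc <;>
          rw [h, hc] <;> norm_num
      · have hc : (F.erase i₀).card = 0 := by omega
        rw [h, hc]
        norm_num
    · intro h2
      have h := h2 i₀ hi₀
      have hm : m i₀ = 2 := by omega
      rw [hsum, hm]
      rcases (show (F.erase i₀).card = 0 ∨ (F.erase i₀).card = 1 by omega) with hc | hc <;>
        rw [hc] <;> norm_num
    · intro h2
      have := h2 i₀ hi₀
      omega
  · push Not at hbig
    have hall : ∀ i ∈ F, m i = 1 := by
      intro i hi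
      have := h1 i hi
      have := hbig i hi
      omega
    have hsum : ∑ i ∈ F, (6 : ℚ) ^ (m i - 1) = (F.card : ℚ) := by
      rw [Finset.sum_congr rfl (fun i hi => by rw [hall i hi, Nat.sub_self, pow_zero])]
      rw [Finset.sum_const, nsmul_eq_mul, mul_one]
    have hcard : F.card ≤ 3 := by
      have : ∑ i ∈ F, m i = F.card := by
        rw [Finset.sum_congr rfl (fun i hi => hall i hi), Finset.sum_const, smul_eq_mul, mul_one]
      omega
    have hc : (F.card : ℚ) ≤ 3 := by exact_mod_cast hcard
    rw [hsum]
    exact ⟨by linarith, fun _ => by linarith, fun _ => by linarith⟩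

/-- **The fibre bound for triple witnesses.**  Fix `S = B ∪ X` (`B ⊆ G` of rank `3`, `X` a `3`-set off `G`) and a
line `L` of `M|B` with `k = |L ∩ B|`.  The planes `P ≠ G` with rank-`3` trace on `S` and `P ∩ B = L ∩ B` are the
`cl(L ∪ {w})`, `w ∈ P ∩ X`, so their traces on `X` are pairwise disjoint: they contribute at most `36 · 6^{k−2}`,
at most `7 · 6^{k−2}` when `ρ(S) ≥ 5` (no such plane contains `X`), and at most `3 · 6^{k−2}` when `ρ(S) = 6`
(no such plane contains two points of `X`). -/
theorem triple_fibre_le (hs : Simple M) {G B L : Finset α} (hG : G ∈ planes M) (hB : B ⊆ G)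
    (hrB : M.eRk (B : Set α) = 3) (hL : L ∈ lines M) (hLG : L ⊆ G) (hLcard : 2 ≤ (L ∩ B).card)
    {X : Finset α} (hX : X ⊆ gr M) (hXG : Disjoint X G) (hX3 : X.card = 3)
    (F : Finset (Finset α))
    (hF : ∀ P ∈ F, P ∈ planes M ∧ P ≠ G ∧ M.eRk (((B ∪ X) ∩ P : Finset α) : Set α) = 3 ∧
      P ∩ B = L ∩ B ∧ L ⊆ P) :
    ∑ P ∈ F, fRule M P (B ∪ X) ≤ 36 * (6 : ℚ) ^ ((L ∩ B).card - 2) ∧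
    ((5 : ℕ∞) ≤ M.eRk ((B ∪ X : Finset α) : Set α) →
      ∑ P ∈ F, fRule M P (B ∪ X) ≤ 7 * (6 : ℚ) ^ ((L ∩ B).card - 2)) ∧
    (M.eRk ((B ∪ X : Finset α) : Set α) = 6 →
      ∑ P ∈ F, fRule M P (B ∪ X) ≤ 3 * (6 : ℚ) ^ ((L ∩ B).card - 2)) := by
  classical
  have hLcard' : 2 ≤ L.card := hLcard.trans (Finset.card_le_card Finset.inter_subset_left)
  have hXg : ∀ w ∈ X, w ∈ gr M := fun w hw => hX hw
  have hXG' : ∀ w ∈ X, w ∉ G := fun w hw => Finset.disjoint_left.1 hXG hw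
  have hrule : ∀ P ∈ F, fRule M P (B ∪ X) = (6 : ℚ) ^ (((B ∪ X) ∩ P).card - 3) := by
    intro P hP
    unfold fRule
    rw [if_pos (hF P hP).2.2.1]
  have hclP : ∀ P ∈ F, ∀ w ∈ P ∩ X, P = clF M (insert w L) := by
    intro P hP w hw
    obtain ⟨hPpl, -, -, -, hLP⟩ := hF P hP
    rw [Finset.mem_inter] at hw
    exact plane_eq_clF_insert hs hPpl hL hLP hLG hLcard' (hXg w hw.2) (hXG' w hw.2) hw.1
  have hmeet : ∀ P ∈ F, (P ∩ X).Nonempty := by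
    intro P hP
    obtain ⟨hPpl, hne, hr3, -, -⟩ := hF P hP
    exact triple_meets hG hPpl hne hB hr3
  -- the traces on `X` are pairwise disjoint
  have hdisj : ∀ P ∈ F, ∀ P' ∈ F, P ≠ P' → Disjoint (P ∩ X) (P' ∩ X) := by
    intro P hP P' hP' hne
    rw [Finset.disjoint_left]
    intro w hw hw'
    exact hne ((hclP P hP w hw).trans (hclP P' hP' w hw').symm)
  have hsumcard : ∑ P ∈ F, (P ∩ X).card ≤ 3 := by
    calc ∑ P ∈ F, (P ∩ X).card = (F.biUnion (fun P => P ∩ X)).card := (Finset.card_biUnion hdisj).symm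
      _ ≤ X.card := by
          apply Finset.card_le_card
          rw [Finset.biUnion_subset]
          intro P _
          exact Finset.inter_subset_right
      _ = 3 := hX3
  have hone : ∀ P ∈ F, 1 ≤ (P ∩ X).card := fun P hP => Nat.succ_le_of_lt (Finset.card_pos.2 (hmeet P hP))
  -- termwise: `f(P, S) ≤ 6^{k−2} · 6^{|P ∩ X| − 1}`
  have hterm : ∀ P ∈ F, fRule M P (B ∪ X) ≤
      (6 : ℚ) ^ ((L ∩ B).card - 2) * (6 : ℚ) ^ ((P ∩ X).card - 1) := by
    intro P hP
    rw [hrule P hP, ← pow_add]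
    apply six_pow_le
    have h1 := trace_union_card_le P B X
    rw [(hF P hP).2.2.2.1] at h1
    have := hone P hP
    omega
  have hsumle : ∑ P ∈ F, fRule M P (B ∪ X) ≤
      (6 : ℚ) ^ ((L ∩ B).card - 2) * ∑ P ∈ F, (6 : ℚ) ^ ((P ∩ X).card - 1) := by
    rw [Finset.mul_sum]
    exact Finset.sum_le_sum hterm
  obtain ⟨hc36, hc7, hc3⟩ := sum_six_pow_classes_le F (fun P => (P ∩ X).card) hone hsumcard
  have hpos : (0 : ℚ) ≤ (6 : ℚ) ^ ((L ∩ B).card - 2) := by positivity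
  -- the rank-`2` trace of `L` on `B` inside `B ∩ (L ∪ Z)`
  have hrBZ : ∀ Z : Finset α, (2 : ℕ∞) ≤ M.eRk ((B ∩ (L ∪ Z) : Finset α) : Set α) := by
    intro Z
    have hsub2 : L ∩ B ⊆ B ∩ (L ∪ Z) := by
      intro y hy
      rw [Finset.mem_inter] at hy
      rw [Finset.mem_inter, Finset.mem_union]
      exact ⟨hy.2, Or.inl hy.1⟩
    have hr2 : M.eRk ((L ∩ B : Finset α) : Set α) = 2 :=
      eRk_eq_two_of_subset_line hs hL Finset.inter_subset_left hLcard
    rw [← hr2]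
    exact M.eRk_mono (Finset.coe_subset.2 hsub2)
  refine ⟨?_, ?_, ?_⟩
  · calc ∑ P ∈ F, fRule M P (B ∪ X) ≤ _ := hsumle
      _ ≤ (6 : ℚ) ^ ((L ∩ B).card - 2) * 36 := mul_le_mul_of_nonneg_left hc36 hpos
      _ = 36 * (6 : ℚ) ^ ((L ∩ B).card - 2) := by ring
  · intro hr5
    -- no plane of the fibre contains all of `X`
    have h2 : ∀ P ∈ F, (P ∩ X).card ≤ 2 := by
      intro P hP
      by_contra hgt
      push Not at hgt
      have hXP : X ⊆ P := by
        have hle : X.card ≤ (P ∩ X).card := by rw [hX3]; exact hgt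
        exact (Finset.eq_of_subset_of_card_le Finset.inter_subset_right hle).symm ▸ Finset.inter_subset_left
      obtain ⟨hPpl, -, -, -, hLP⟩ := hF P hP
      have hZ : L ∪ X ⊆ P := Finset.union_subset hLP hXP
      have hrZ : M.eRk ((L ∪ X : Finset α) : Set α) ≤ 3 := by
        calc M.eRk ((L ∪ X : Finset α) : Set α) ≤ M.eRk (P : Set α) := M.eRk_mono (Finset.coe_subset.2 hZ)
          _ = 3 := (mem_planes.1 hPpl).2.2
      have h4 := eRk_union_le_four hrB hrZ (hrBZ X)
      have hSsub : B ∪ X ⊆ B ∪ (L ∪ X) := by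
        intro y hy
        rw [Finset.mem_union] at hy
        rw [Finset.mem_union, Finset.mem_union]
        rcases hy with hy | hy
        · exact Or.inl hy
        · exact Or.inr (Or.inr hy)
      have h5 : M.eRk ((B ∪ X : Finset α) : Set α) ≤ 4 :=
        (M.eRk_mono (Finset.coe_subset.2 hSsub)).trans h4
      have : (5 : ℕ∞) ≤ 4 := hr5.trans h5
      exact absurd this (by decide)
    calc ∑ P ∈ F, fRule M P (B ∪ X) ≤ _ := hsumle
      _ ≤ (6 : ℚ) ^ ((L ∩ B).card - 2) * 7 := mul_le_mul_of_nonneg_left (hc7 h2) hpos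
      _ = 7 * (6 : ℚ) ^ ((L ∩ B).card - 2) := by ring
  · intro hr6
    -- no plane of the fibre contains two points of `X`
    have h1 : ∀ P ∈ F, (P ∩ X).card ≤ 1 := by
      intro P hP
      by_contra hgt
      push Not at hgt
      obtain ⟨w, hw, w', hw', hww'⟩ := Finset.one_lt_card.1 hgt
      obtain ⟨hPpl, -, -, -, hLP⟩ := hF P hP
      have hpair : ({w, w'} : Finset α) ⊆ P := by
        intro y hy
        rw [Finset.mem_insert, Finset.mem_singleton] at hy
        rcases hy with rfl | rfl
        · exact (Finset.mem_inter.1 hw).1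
        · exact (Finset.mem_inter.1 hw').1
      have hpairX : ({w, w'} : Finset α) ⊆ X := by
        intro y hy
        rw [Finset.mem_insert, Finset.mem_singleton] at hy
        rcases hy with rfl | rfl
        · exact (Finset.mem_inter.1 hw).2
        · exact (Finset.mem_inter.1 hw').2
      have hZ : L ∪ {w, w'} ⊆ P := Finset.union_subset hLP hpair
      have hrZ : M.eRk ((L ∪ {w, w'} : Finset α) : Set α) ≤ 3 := by
        calc M.eRk ((L ∪ {w, w'} : Finset α) : Set α) ≤ M.eRk (P : Set α) :=
              M.eRk_mono (Finset.coe_subset.2 hZ)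
          _ = 3 := (mem_planes.1 hPpl).2.2
      have h4 := eRk_union_le_four hrB hrZ (hrBZ {w, w'})
      -- `B ∪ X ⊆ (B ∪ (L ∪ {w, w′})) ∪ (X \ {w, w′})`, the last set a single point
      have hSsub : B ∪ X ⊆ (B ∪ (L ∪ {w, w'})) ∪ (X \ {w, w'}) := by
        intro y hy
        rw [Finset.mem_union] at hy
        rw [Finset.mem_union, Finset.mem_union, Finset.mem_union, Finset.mem_sdiff]
        rcases hy with hy | hy
        · exact Or.inl (Or.inl hy)
        · by_cases hyp : y ∈ ({w, w'} : Finset α)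
          · exact Or.inl (Or.inr (Or.inr hyp))
          · exact Or.inr ⟨hy, hyp⟩
      have hcard1 : (X \ {w, w'}).card ≤ 1 := by
        rw [Finset.card_sdiff, Finset.inter_eq_left.2 hpairX, Finset.card_pair hww', hX3]
      have hr1 : M.eRk ((X \ {w, w'} : Finset α) : Set α) ≤ 1 :=
        (eRk_le_card _).trans (by exact_mod_cast hcard1)
      have h5 : M.eRk ((B ∪ X : Finset α) : Set α) ≤ 5 := by
        calc M.eRk ((B ∪ X : Finset α) : Set α)
            ≤ M.eRk (((B ∪ (L ∪ {w, w'})) ∪ (X \ {w, w'}) : Finset α) : Set α) :=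
              M.eRk_mono (Finset.coe_subset.2 hSsub)
          _ ≤ M.eRk ((B ∪ (L ∪ {w, w'}) : Finset α) : Set α) +
                M.eRk ((X \ {w, w'} : Finset α) : Set α) := by
              rw [Finset.coe_union]
              exact M.eRk_union_le_eRk_add_eRk _ _
          _ ≤ 4 + 1 := add_le_add h4 hr1
          _ = 5 := by norm_num
      rw [hr6] at h5
      exact absurd h5 (by decide)
    calc ∑ P ∈ F, fRule M P (B ∪ X) ≤ _ := hsumle
      _ ≤ (6 : ℚ) ^ ((L ∩ B).card - 2) * 3 := mul_le_mul_of_nonneg_left (hc3 h1) hpos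
      _ = 3 * (6 : ℚ) ^ ((L ∩ B).card - 2) := by ring

end SevenThree

end PercRepro
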